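import Literature.AlgebraicGeometry.Limits.SubalgebraSpread
import Literature.AlgebraicGeometry.Limits.SliceBaseChange
import Literature.AlgebraicGeometry.Limits.GrpTransfer
import Literature.AlgebraicGeometry.Limits.SeparatedSchematicExt
import Mathlib.AlgebraicGeometry.Morphisms.Flat
import HarnessLib

/-!
# Limits of schemes: a group law over `Spec B`, `B = ⋃ K[t]`, descends to a finitely generated subalgebra (EGA IV₃ 8.8.2)

Topic: `Literature/AlgebraicGeometry/Limits`; the twin of `Limits/LocalizationGroupSpread` (group
laws over a LOCALIZATION `Spec A_S = lim Spec A[1/s]`) for the SUBALGEBRA diagram of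
`Limits/SubalgebraDiagram` / `Limits/SubalgebraSpread`: a commutative `K`-algebra `B` is the
directed union of its finitely generated `K`-subalgebras `K[t]` (`t ⊇ s₁` finite), and for a
`K`-scheme `P` one has `(P ⊗ Spec B).left = lim_t (P ⊗ Spec K[t]).left` (Stacks 01YT). Let
`P → Spec K` be quasi-compact, quasi-separated and locally of finite presentation, and suppose the
base change `P_B = P ×_K Spec B → Spec B` carries the structure of a group scheme over `B`. Then:

* `exists_grpSpread` — the three structure morphisms spread out to a common stage: for some finite
  `t ⊆ B` there are `K`-morphisms `(P ⊗ P) ⊗ Spec K[t] → P`, `𝟙 ⊗ Spec K[t] → P`,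
  `P ⊗ Spec K[t] → P` restricting over `Spec B` to the multiplication, unit and inverse of `P_B`
  (Stacks 01ZC, surjectivity half, `SubalgApprox.exists_π_app_comp_eq`); such data restrict to
  finer stages (`GrpSpread.restrict`);
* `GrpSpread.grpObj` — **if `P_t = P ×_K Spec K[t] → Spec K[t]` is flat and separated and
  `Spec B → Spec K[t]` is schematically dominant (e.g. `B` reduced: `K[t] ⊆ B` is injective —
  `isSchemeTheoreticallyDominant_baseLeg_left`), these morphisms form a group-scheme structure on
  `P_t` over `K[t]`** whose base change along `Spec B → Spec K[t]` is the given one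
  (`GrpSpread.isMonHom_legFacObjIso_hom`: the canonical `(P_t)_B ≅ P_B` is an isomorphism of group
  schemes). The axioms transfer because base change to `Spec B` is *injective* on morphisms from
  flat `K[t]`-schemes to the separated `P_t` (`Limits/SeparatedSchematicExt`), packaged as
  `Limits/GrpTransfer`.

This is the group-scheme case of EGA IV₃ Thm. 8.8.2 / Stacks 01ZM–01ZC for the limit
`Spec B = lim Spec K[t]`, in the form needed to descend an abelian variety over a field extension
`L ⊇ k` whose underlying scheme is defined over `k` to a group scheme over a finitely generated
`k`-subalgebra of `L` ("`A` is defined over a subfield finitely generated over the prime field",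
Milne, *Abelian Varieties*, proof of Cor. 20.4 / Rem. 20.9; the standard first step of every
specialisation argument). Everything is proved; the definitions are the bookkeeping structure
`GrpSpread` and abbreviations, exactly as in `Limits/LocalizationGroupSpread`.

## References

* A. Grothendieck, EGA IV₃, Thm. 8.8.2 (Publ. Math. IHÉS 28, 1966). [EGAIV3]
* The Stacks project, Tags 01ZC, 01ZM. [StacksProject]
* U. Görtz, T. Wedhorn, *Algebraic Geometry I*, 2nd ed. (2020), Thm. 10.57, Thm. 10.66. [GortzWedhorn2020]
-/

noncomputable section

universe u

open CategoryTheory CategoryTheory.Limits AlgebraicGeometry MonoidalCategory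
  CartesianMonoidalCategory MonObj
open Functor.LaxMonoidal Functor.OplaxMonoidal
open scoped CategoryTheory.Obj

namespace Literature.AlgebraicGeometry.Limits

namespace SubalgGrpSpread

open Literature.AlgebraicGeometry.Motives (SchemeOver specOver)
open SubalgApprox

set_option backward.isDefEq.respectTransparency false

variable (K : Type u) [CommRing K] (B : Type u) [CommRing B] [Algebra K B] (s₁ : Finset B)

/-! ## The legs `Spec B → Spec K[t]` -/

/-- The leg `Spec B → Spec K[t]` of the cone `Spec B = lim_t Spec K[t]` of `K`-schemes
(`SubalgApprox.baseCone`). [folklore] -/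
abbrev baseLeg (t : (Idx B s₁)ᵒᵖ) : specOver K B ⟶ (baseDiagram K B s₁).obj t :=
  (baseCone K B s₁).π.app t

variable {s₁} in
/-- The legs commute with the transition maps `Spec K[t] → Spec K[t']`, `t ⊇ t'`. [folklore] -/
@[reassoc]
private theorem baseLeg_comp_map {t t' : (Idx B s₁)ᵒᵖ} (ρ : t ⟶ t') :
    baseLeg K B s₁ t ≫ (baseDiagram K B s₁).map ρ = baseLeg K B s₁ t' :=
  (baseCone K B s₁).w ρ

/-- The legs `Spec B → Spec K[t]` are quasi-compact (affine). [folklore] -/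
instance quasiCompact_baseLeg_left (t : (Idx B s₁)ᵒᵖ) : QuasiCompact (baseLeg K B s₁ t).left := by
  haveI : IsAffineHom (baseLeg K B s₁ t).left :=
    SubalgApprox.isAffineHom_baseCone_π_app_left K B s₁ t
  infer_instance

/-- For `B` reduced, the legs `Spec B → Spec K[t]` are scheme-theoretically dominant: `K[t] ⊆ B`
is injective and `K[t]` is reduced (`isSchemeTheoreticallyDominant_specMap_of_injective`).
[cite: GortzWedhorn2020, Rem. 9.20] -/
instance isSchemeTheoreticallyDominant_baseLeg_left [IsReduced B] (t : (Idx B s₁)ᵒᵖ) :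
    IsSchemeTheoreticallyDominant (baseLeg K B s₁ t).left := by
  haveI : IsReduced (sub K B t.unop.1) :=
    isReduced_of_injective (sub K B t.unop.1).val.toRingHom Subtype.val_injective
  exact isSchemeTheoreticallyDominant_specMap_of_injective (sub K B t.unop.1).val.toRingHom
    Subtype.val_injective

/-! ## The objects: `P_B`, the stages `P_t`, restriction to `Spec B` -/

/-- Restriction from `K[t]`-schemes to `B`-schemes: base change along the leg
`Spec B → Spec K[t]`. [folklore] -/
abbrev legPullback (t : (Idx B s₁)ᵒᵖ) :
    Over ((baseDiagram K B s₁).obj t).left ⥤ Over (specOver K B).left :=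
  Over.pullback (baseLeg K B s₁ t).left

/-- Transitivity of base change `(–)_t|_B ≅ (–)_B` as a (monoidal) natural isomorphism of functors
`SchemeOver K ⥤ Over (Spec B)` (`Limits/SliceBaseChange.pullbackFacIso`). [folklore] -/
abbrev legFacIso (t : (Idx B s₁)ᵒᵖ) :
    Over.pullback ((baseDiagram K B s₁).obj t).hom ⋙ legPullback K B s₁ t ≅
      Over.pullback (specOver K B).hom :=
  pullbackFacIso ((baseDiagram K B s₁).obj t).hom (baseLeg K B s₁ t).left (specOver K B).hom
    (Over.w (baseLeg K B s₁ t))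

variable {K}
variable (P : SchemeOver K)

/-- `P_B = P ×_K Spec B` as a `B`-scheme. [folklore] -/
abbrev limObj : Over (specOver K B).left := (Over.pullback (specOver K B).hom).obj P

/-- The stage `P_t = P ×_K Spec K[t]` as a `K[t]`-scheme. [folklore] -/
abbrev stageObj (t : (Idx B s₁)ᵒᵖ) : Over ((baseDiagram K B s₁).obj t).left :=
  (Over.pullback ((baseDiagram K B s₁).obj t).hom).obj P

/-- `(Q_t)_B ≅ Q_B`: restriction of the stage of `Q` to `Spec B` is the base change of `Q` to
`Spec B` (`Limits/SliceBaseChange.pullbackFacObjIso` for `Spec B → Spec K[t] → Spec K`). [folklore] -/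
abbrev legFacObjIso (t : (Idx B s₁)ᵒᵖ) (Q : SchemeOver K) :
    (legPullback K B s₁ t).obj ((Over.pullback ((baseDiagram K B s₁).obj t).hom).obj Q) ≅
      (Over.pullback (specOver K B).hom).obj Q :=
  pullbackFacObjIso ((baseDiagram K B s₁).obj t).hom (baseLeg K B s₁ t).left (specOver K B).hom
    (Over.w (baseLeg K B s₁ t)) Q

/-! ## Monoidality of `(Q_t)_B ≅ Q_B` in explicit form -/

section Monoidal

variable (t : (Idx B s₁)ᵒᵖ)

/-- Tensor compatibility of the natural isomorphism `(–)_t|_B ≅ (–)_B` (a natural transformation of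
cartesian-monoidal functors is monoidal, Mathlib `NatTrans.IsMonoidal.of_cartesianMonoidalCategory`),
solved for the base change of `μ : Q_t ⊗ R_t ≅ (Q ⊗ R)_t`. [folklore] -/
@[reassoc]
private theorem map_μ_comp_legFacObjIso_hom (Q R : SchemeOver K) :
    (legPullback K B s₁ t).map
        (Functor.LaxMonoidal.μ (Over.pullback ((baseDiagram K B s₁).obj t).hom) Q R) ≫
      (legFacObjIso B s₁ t (Q ⊗ R)).hom =
    Functor.OplaxMonoidal.δ (legPullback K B s₁ t)
        ((Over.pullback ((baseDiagram K B s₁).obj t).hom).obj Q)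
        ((Over.pullback ((baseDiagram K B s₁).obj t).hom).obj R) ≫
      ((legFacObjIso B s₁ t Q).hom ⊗ₘ (legFacObjIso B s₁ t R).hom) ≫
        Functor.LaxMonoidal.μ (Over.pullback (specOver K B).hom) Q R := by
  have e := NatTrans.IsMonoidal.tensor (τ := (legFacIso K B s₁ t).hom) Q R
  rw [Functor.LaxMonoidal.comp_μ, Category.assoc] at e
  rw [← cancel_epi (Functor.LaxMonoidal.μ (legPullback K B s₁ t)
    ((Over.pullback ((baseDiagram K B s₁).obj t).hom).obj Q)
    ((Over.pullback ((baseDiagram K B s₁).obj t).hom).obj R)), Functor.Monoidal.μ_δ_assoc]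
  exact e

/-- Unit compatibility of `(–)_t|_B ≅ (–)_B`, solved for the base change of `ε : 𝟙 ≅ 𝟙_t`. [folklore] -/
@[reassoc]
private theorem map_ε_comp_legFacObjIso_hom :
    (legPullback K B s₁ t).map
        (Functor.LaxMonoidal.ε (Over.pullback ((baseDiagram K B s₁).obj t).hom)) ≫
      (legFacObjIso B s₁ t (𝟙_ (SchemeOver K))).hom =
    Functor.OplaxMonoidal.η (legPullback K B s₁ t) ≫
      Functor.LaxMonoidal.ε (Over.pullback (specOver K B).hom) := by
  have e := NatTrans.IsMonoidal.unit (τ := (legFacIso K B s₁ t).hom)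
  rw [Functor.LaxMonoidal.comp_ε, Category.assoc] at e
  rw [← cancel_epi (Functor.LaxMonoidal.ε (legPullback K B s₁ t)), Functor.Monoidal.ε_η_assoc]
  exact e

end Monoidal

/-! ## Spreading out of `K`-morphisms `P ⊗ Spec B → X` (Stacks 01ZC, surjectivity) -/

/-- **Surjectivity half of Stacks 01ZC for the subalgebra diagram, in `K`-morphism form.** Let
`P → Spec K` be quasi-compact and quasi-separated and `X → Spec K` locally of finite presentation.
Every `K`-morphism `P ⊗ Spec B → X` is the restriction of a `K`-morphism `P ⊗ Spec K[t] → X` for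
some finite `t ⊆ B` (`SubalgApprox.exists_π_app_comp_eq` over the base `Spec K`).
[cite: StacksProject, Tag 01ZC] [cite: GortzWedhorn2020, Thm. 10.57] -/
theorem exists_whiskerLeft_comp_eq [QuasiCompact P.hom] [QuasiSeparated P.hom] {X : SchemeOver K}
    [LocallyOfFinitePresentation X.hom] (a : P ⊗ specOver K B ⟶ X) :
    ∃ (t : (Idx B s₁)ᵒᵖ) (g : P ⊗ (baseDiagram K B s₁).obj t ⟶ X),
      (P ◁ baseLeg K B s₁ t) ≫ g = a := by
  obtain ⟨t, g, hg, hg'⟩ := SubalgApprox.exists_π_app_comp_eq s₁ P (𝟙 _) X.hom a.left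
    (by rw [Category.comp_id]; exact Over.w a)
  refine ⟨t, Over.homMk g (by rw [hg', Category.comp_id]), ?_⟩
  ext : 1
  exact hg

/-! ## The structure maps of `P_B` as `K`-morphisms, and their spreadings -/

section Ext

variable [GrpObj (limObj B P)]

/-- The multiplication of `P_B`, as a `K`-morphism `(P ⊗ P) ⊗ Spec B → P`. [folklore] -/
def mulExt : (P ⊗ P) ⊗ specOver K B ⟶ P :=
  unsliceHom (specOver K B)
    (Functor.OplaxMonoidal.δ (Over.pullback (specOver K B).hom) P P ≫ μ[limObj B P])

/-- The unit of `P_B`, as a `K`-morphism `𝟙 ⊗ Spec B → P`. [folklore] -/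
def oneExt : 𝟙_ (SchemeOver K) ⊗ specOver K B ⟶ P :=
  unsliceHom (specOver K B)
    (Functor.OplaxMonoidal.η (Over.pullback (specOver K B).hom) ≫ η[limObj B P])

/-- The inverse of `P_B`, as a `K`-morphism `P ⊗ Spec B → P`. [folklore] -/
def invExt : P ⊗ specOver K B ⟶ P :=
  unsliceHom (specOver K B) ι[limObj B P]

/-- `GrpSpread B s₁ P t`: spreadings to the stage `Spec K[t]` of the multiplication, unit and
inverse of `P_B` — `K`-morphisms out of `(P ⊗ P) ⊗ Spec K[t]`, `𝟙 ⊗ Spec K[t]`,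
`P ⊗ Spec K[t]` restricting over `Spec B` to `mulExt`, `oneExt`, `invExt`.
[cite: EGAIV3, Thm. 8.8.2 (i)] -/
structure GrpSpread (t : (Idx B s₁)ᵒᵖ) where
  /-- spreading of the multiplication -/
  gm : (P ⊗ P) ⊗ (baseDiagram K B s₁).obj t ⟶ P
  /-- spreading of the unit -/
  ge : 𝟙_ (SchemeOver K) ⊗ (baseDiagram K B s₁).obj t ⟶ P
  /-- spreading of the inverse -/
  gi : P ⊗ (baseDiagram K B s₁).obj t ⟶ P
  /-- `gm` restricts to the multiplication -/
  hm : ((P ⊗ P) ◁ baseLeg K B s₁ t) ≫ gm = mulExt B P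
  /-- `ge` restricts to the unit -/
  he : (𝟙_ (SchemeOver K) ◁ baseLeg K B s₁ t) ≫ ge = oneExt B P
  /-- `gi` restricts to the inverse -/
  hi : (P ◁ baseLeg K B s₁ t) ≫ gi = invExt B P

variable {B s₁ P}

/-- Spreadings restrict to finer stages. [folklore] -/
def GrpSpread.restrict {t t' : (Idx B s₁)ᵒᵖ} (d : GrpSpread B s₁ P t') (ρ : t ⟶ t') :
    GrpSpread B s₁ P t where
  gm := ((P ⊗ P) ◁ (baseDiagram K B s₁).map ρ) ≫ d.gm
  ge := (𝟙_ (SchemeOver K) ◁ (baseDiagram K B s₁).map ρ) ≫ d.ge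
  gi := (P ◁ (baseDiagram K B s₁).map ρ) ≫ d.gi
  hm := by rw [← MonoidalCategory.whiskerLeft_comp_assoc, baseLeg_comp_map, d.hm]
  he := by rw [← MonoidalCategory.whiskerLeft_comp_assoc, baseLeg_comp_map, d.he]
  hi := by rw [← MonoidalCategory.whiskerLeft_comp_assoc, baseLeg_comp_map, d.hi]

variable (B s₁ P)

/-- **The structure maps of `P_B` spread out to a common stage** (`P` quasi-compact,
quasi-separated and locally of finite presentation over `K`): three applications of the
surjectivity half of Stacks 01ZC (`exists_whiskerLeft_comp_eq`) and a common refinement of the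
three stages. [cite: StacksProject, Tag 01ZC] [cite: EGAIV3, Thm. 8.8.2 (i)] -/
theorem exists_grpSpread [QuasiCompact P.hom] [QuasiSeparated P.hom]
    [LocallyOfFinitePresentation P.hom] : ∃ t : (Idx B s₁)ᵒᵖ, Nonempty (GrpSpread B s₁ P t) := by
  haveI : QuasiCompact (P ⊗ P).hom :=
    inferInstanceAs (QuasiCompact (pullback.fst P.hom P.hom ≫ P.hom))
  haveI : QuasiSeparated (P ⊗ P).hom :=
    inferInstanceAs (QuasiSeparated (pullback.fst P.hom P.hom ≫ P.hom))
  haveI : QuasiCompact (𝟙_ (SchemeOver K)).hom :=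
    inferInstanceAs (QuasiCompact (𝟙 (Spec (CommRingCat.of K))))
  haveI : QuasiSeparated (𝟙_ (SchemeOver K)).hom :=
    inferInstanceAs (QuasiSeparated (𝟙 (Spec (CommRingCat.of K))))
  obtain ⟨t₁, g₁, h₁⟩ := exists_whiskerLeft_comp_eq B s₁ (P ⊗ P) (mulExt B P)
  obtain ⟨t₂, g₂, h₂⟩ := exists_whiskerLeft_comp_eq B s₁ (𝟙_ (SchemeOver K)) (oneExt B P)
  obtain ⟨t₃, g₃, h₃⟩ := exists_whiskerLeft_comp_eq B s₁ P (invExt B P)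
  obtain ⟨r, ⟨ρ₁⟩, ⟨ρ₂⟩⟩ := exists_hom₂ B s₁ t₁ t₂
  obtain ⟨t, ⟨σ⟩, ⟨ρ₃⟩⟩ := exists_hom₂ B s₁ r t₃
  refine ⟨t, ⟨⟨((P ⊗ P) ◁ (baseDiagram K B s₁).map (σ ≫ ρ₁)) ≫ g₁,
    (𝟙_ (SchemeOver K) ◁ (baseDiagram K B s₁).map (σ ≫ ρ₂)) ≫ g₂,
    (P ◁ (baseDiagram K B s₁).map ρ₃) ≫ g₃, ?_, ?_, ?_⟩⟩⟩
  · rw [← MonoidalCategory.whiskerLeft_comp_assoc, baseLeg_comp_map, h₁]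
  · rw [← MonoidalCategory.whiskerLeft_comp_assoc, baseLeg_comp_map, h₂]
  · rw [← MonoidalCategory.whiskerLeft_comp_assoc, baseLeg_comp_map, h₃]

end Ext

/-! ## The group structure on a flat separated stage -/

section Transfer

variable {B s₁ P} {t : (Idx B s₁)ᵒᵖ} [GrpObj (limObj B P)]

/-- The group structure on `(P_t)_B` transported from `P_B` along `(P_t)_B ≅ P_B`. [folklore] -/
abbrev grpObjLegObj (t : (Idx B s₁)ᵒᵖ) : GrpObj ((legPullback K B s₁ t).obj (stageObj B s₁ P t)) :=
  GrpObj.ofIso (legFacObjIso B s₁ t P).symm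

attribute [local instance] grpObjLegObj

/-- The candidate multiplication on the stage `P_t`: `P_t ⊗ P_t ≅ (P ⊗ P)_t → P_t`, the second map
being the `K[t]`-morphism attached to the spreading `gm : (P ⊗ P) ⊗ Spec K[t] → P`. [folklore] -/
def GrpSpread.mul (d : GrpSpread B s₁ P t) : stageObj B s₁ P t ⊗ stageObj B s₁ P t ⟶ stageObj B s₁ P t :=
  Functor.LaxMonoidal.μ (Over.pullback ((baseDiagram K B s₁).obj t).hom) P P ≫
    sliceHom ((baseDiagram K B s₁).obj t) d.gm

/-- The candidate unit on the stage `P_t`: `𝟙 ≅ 𝟙_t → P_t`. [folklore] -/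
def GrpSpread.one (d : GrpSpread B s₁ P t) :
    𝟙_ (Over ((baseDiagram K B s₁).obj t).left) ⟶ stageObj B s₁ P t :=
  Functor.LaxMonoidal.ε (Over.pullback ((baseDiagram K B s₁).obj t).hom) ≫
    sliceHom ((baseDiagram K B s₁).obj t) d.ge

/-- The candidate inverse on the stage `P_t`. [folklore] -/
def GrpSpread.inv (d : GrpSpread B s₁ P t) : stageObj B s₁ P t ⟶ stageObj B s₁ P t :=
  sliceHom ((baseDiagram K B s₁).obj t) d.gi

/-- Base change to `Spec B` of the `K[t]`-morphism attached to `gm`: it is the multiplication of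
`P_B` (conjugated by `(P ⊗ P)_t|_B ≅ (P ⊗ P)_B`, `(P_t)_B ≅ P_B`), by `pullback_map_sliceHom` and
`hm`. [folklore] -/
private theorem GrpSpread.map_sliceHom_gm (d : GrpSpread B s₁ P t) :
    (legPullback K B s₁ t).map (sliceHom ((baseDiagram K B s₁).obj t) d.gm) =
      (legFacObjIso B s₁ t (P ⊗ P)).hom ≫
        Functor.OplaxMonoidal.δ (Over.pullback (specOver K B).hom) P P ≫ μ[limObj B P] ≫
          (legFacObjIso B s₁ t P).inv := by
  have e := pullback_map_sliceHom (baseLeg K B s₁ t) (P := P) d.gm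
  rw [d.hm, mulExt, sliceHom_unsliceHom] at e
  simpa only [Category.assoc] using (Iso.eq_comp_inv _).mpr e

/-- Base change to `Spec B` of the `K[t]`-morphism attached to `ge`: the unit of `P_B`. [folklore] -/
private theorem GrpSpread.map_sliceHom_ge (d : GrpSpread B s₁ P t) :
    (legPullback K B s₁ t).map (sliceHom ((baseDiagram K B s₁).obj t) d.ge) =
      (legFacObjIso B s₁ t (𝟙_ (SchemeOver K))).hom ≫
        Functor.OplaxMonoidal.η (Over.pullback (specOver K B).hom) ≫ η[limObj B P] ≫
          (legFacObjIso B s₁ t P).inv := by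
  have e := pullback_map_sliceHom (baseLeg K B s₁ t) (P := P) d.ge
  rw [d.he, oneExt, sliceHom_unsliceHom] at e
  simpa only [Category.assoc] using (Iso.eq_comp_inv _).mpr e

/-- Base change to `Spec B` of the `K[t]`-morphism attached to `gi`: the inverse of `P_B`. [folklore] -/
private theorem GrpSpread.map_sliceHom_gi (d : GrpSpread B s₁ P t) :
    (legPullback K B s₁ t).map (sliceHom ((baseDiagram K B s₁).obj t) d.gi) =
      (legFacObjIso B s₁ t P).hom ≫ ι[limObj B P] ≫ (legFacObjIso B s₁ t P).inv := by
  have e := pullback_map_sliceHom (baseLeg K B s₁ t) (P := P) d.gi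
  rw [d.hi, invExt, sliceHom_unsliceHom] at e
  simpa only [Category.assoc] using (Iso.eq_comp_inv _).mpr e

/-- Restricted to `Spec B`, the candidate multiplication is the multiplication of `(P_t)_B`
(transported from `P_B`): the dictionary commutes with base change (`pullback_map_sliceHom`),
`gm` restricts to `mulExt`, and `(P_t)_B ≅ P_B` is monoidal (cartesian functors). [cite: EGAIV3, Thm. 8.8.2 (i)] -/
theorem GrpSpread.map_mul (d : GrpSpread B s₁ P t) :
    (legPullback K B s₁ t).map d.mul =
      Functor.OplaxMonoidal.δ (legPullback K B s₁ t) (stageObj B s₁ P t) (stageObj B s₁ P t) ≫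
        μ[(legPullback K B s₁ t).obj (stageObj B s₁ P t)] := by
  rw [GrpSpread.mul, Functor.map_comp, d.map_sliceHom_gm, map_μ_comp_legFacObjIso_hom_assoc,
    Functor.Monoidal.μ_δ_assoc, MonObj.ofIso_mul]
  simp only [Iso.symm_inv, Iso.symm_hom]

/-- Restricted to `Spec B`, the candidate unit is the unit of `(P_t)_B`. [cite: EGAIV3, Thm. 8.8.2 (i)] -/
theorem GrpSpread.map_one (d : GrpSpread B s₁ P t) :
    (legPullback K B s₁ t).map d.one =
      Functor.OplaxMonoidal.η (legPullback K B s₁ t) ≫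
        η[(legPullback K B s₁ t).obj (stageObj B s₁ P t)] := by
  rw [GrpSpread.one, Functor.map_comp, d.map_sliceHom_ge, map_ε_comp_legFacObjIso_hom_assoc,
    Functor.Monoidal.ε_η_assoc, MonObj.ofIso_one]
  simp only [Iso.symm_hom]

/-- Restricted to `Spec B`, the candidate inverse is the inverse of `(P_t)_B`. [cite: EGAIV3, Thm. 8.8.2 (i)] -/
theorem GrpSpread.map_inv (d : GrpSpread B s₁ P t) :
    (legPullback K B s₁ t).map d.inv = ι[(legPullback K B s₁ t).obj (stageObj B s₁ P t)] := by
  rw [GrpSpread.inv, d.map_sliceHom_gi, GrpObj.ofIso_inv]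
  simp only [Iso.symm_inv, Iso.symm_hom]

variable [Flat (stageObj B s₁ P t).hom] [IsSeparated (stageObj B s₁ P t).hom]
  [IsSchemeTheoreticallyDominant (baseLeg K B s₁ t).left]

/-- **The lifted group data on a flat separated stage.** With `P_t → Spec K[t]` flat and
separated and `Spec B → Spec K[t]` schematically dominant, restriction to `Spec B` is injective on
morphisms `X → P_t` from flat `K[t]`-schemes `X` (`pullback_map_injective_of_flat`), and the
candidate structure maps lift those of `(P_t)_B`. [cite: EGAIV3, Thm. 8.8.2] -/
def GrpSpread.liftedGrpData (d : GrpSpread B s₁ P t) :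
    LiftedGrpData (legPullback K B s₁ t) (stageObj B s₁ P t) (fun X => Flat X.hom) where
  injective X hX := by
    haveI : Flat X.hom := hX
    exact pullback_map_injective_of_flat (baseLeg K B s₁ t).left
  tensor X Y hX hY := by
    haveI : Flat X.hom := hX
    haveI : Flat Y.hom := hY
    exact inferInstanceAs (Flat (pullback.fst X.hom Y.hom ≫ X.hom))
  unit := inferInstanceAs (Flat (𝟙 _))
  self := ‹_›
  one := d.one
  mul := d.mul
  inv := d.inv
  map_one := d.map_one
  map_mul := d.map_mul
  map_inv := d.map_inv

/-- **The group-scheme structure on the stage `P_t = P ×_K Spec K[t]`** descended from the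
group structure on `P_B` (EGA IV₃ 8.8.2 for the diagrams of a group object): unit,
multiplication and inverse are the spread-out structure maps, and the axioms hold because they
hold after the injective restriction to `Spec B`. [cite: EGAIV3, Thm. 8.8.2] [cite: StacksProject, Tag 01ZM] -/
abbrev GrpSpread.grpObj (d : GrpSpread B s₁ P t) : GrpObj (stageObj B s₁ P t) :=
  d.liftedGrpData.grpObj

/-- **The base change of the descended group scheme `P_t` to `Spec B` is `P_B` as a group
scheme**: the canonical isomorphism `(P_t)_B ≅ P_B` is an isomorphism of group objects, for the
structure on `(P_t)_B` *induced by the monoidal base-change functor* from the descended structure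
(`Functor.monObjObj`) and the given structure on `P_B`. [cite: EGAIV3, Thm. 8.8.2] -/
theorem GrpSpread.isMonHom_legFacObjIso_hom (d : GrpSpread B s₁ P t) :
    letI : GrpObj (stageObj B s₁ P t) := d.grpObj
    @IsMonHom _ _ _ _ _ (Functor.monObjObj (F := legPullback K B s₁ t) (stageObj B s₁ P t))
      inferInstance (legFacObjIso B s₁ t P).hom :=
  LiftedGrpData.isMonHom_hom (legFacObjIso B s₁ t P) d.liftedGrpData

end Transfer

/-! ## Summary: existence of a stage carrying a group structure -/

/-- **A group law over `Spec B` descends to a finitely generated `K`-subalgebra of `B`** (EGA IV₃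
8.8.2 / Stacks 01ZM for the diagrams of a group object; Milne, *Abelian Varieties*, proof of
Cor. 20.4). Let `P → Spec K` be quasi-compact, separated, flat and locally of finite presentation
(e.g. any separated scheme of finite type over a field `K`), `B` a reduced `K`-algebra and suppose
`P ×_K Spec B` is a group scheme over `B`. Then for some finite `t ⊆ B` (containing any prescribed
`s₁`) the stage `P_t = P ×_K Spec K[t]` carries a group-scheme structure over `K[t]` whose base
change along `Spec B → Spec K[t]`, compared through `(P_t)_B ≅ P_B`, is the given one.
[cite: EGAIV3, Thm. 8.8.2] [cite: StacksProject, Tag 01ZM] -/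
theorem exists_stage_grpObj [IsReduced B] [QuasiCompact P.hom] [IsSeparated P.hom] [Flat P.hom]
    [LocallyOfFinitePresentation P.hom] [GrpObj (limObj B P)] :
    ∃ (t : (Idx B s₁)ᵒᵖ) (G : GrpObj (stageObj B s₁ P t)),
      letI : GrpObj (stageObj B s₁ P t) := G
      @IsMonHom _ _ _ _ _ (Functor.monObjObj (F := legPullback K B s₁ t) (stageObj B s₁ P t))
        inferInstance (legFacObjIso B s₁ t P).hom := by
  haveI : QuasiSeparated P.hom := inferInstance
  obtain ⟨t, ⟨d⟩⟩ := exists_grpSpread B s₁ P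
  haveI : Flat (stageObj B s₁ P t).hom :=
    inferInstanceAs (Flat (pullback.snd P.hom ((baseDiagram K B s₁).obj t).hom))
  haveI : IsSeparated (stageObj B s₁ P t).hom :=
    inferInstanceAs (IsSeparated (pullback.snd P.hom ((baseDiagram K B s₁).obj t).hom))
  exact ⟨t, d.grpObj, d.isMonHom_legFacObjIso_hom⟩

end SubalgGrpSpread

end Literature.AlgebraicGeometry.Limits

end
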